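import Literature.MathematicalPhysics.QuantumFieldTheory.Balaban1983to89.Node00.OpsYDeltaALocal
import Literature.MathematicalPhysics.QuantumFieldTheory.Balaban1983to89.Node00.OpsYGauge
import Literature.MathematicalPhysics.QuantumFieldTheory.Balaban1983to89.B9Thm37CubeCoverCommutators

/-!
# `Balaban1983to89.B9DeltaALocalGaugeCovY` — (3.33)–(3.34) FOR THE LOCAL LETTERS: the Dirichlet cube inverse `G′_□(U)`, print's local gauge
# projection `R_□(U)`, the local bond operator `Δ_{a,□}(U)`, its padded compression and its inverse `G_□(U)` (node00-def-Y's FILES 35 ∕ 40) ARE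
# GAUGE COVARIANT — `T(U^u) R(u) = R(u) T(U)` in def-Y's `Intw ∕ conjY ∕ gaugeY` calculus (`Node00.OpsYGauge`)

statement-level skeleton of published theorems with citation tags; proofs where landed; nothing here is a claim about the Yang–Mills mass gap

Sources.  T. Bałaban, *Propagators for lattice gauge theories in a background field*, Commun. Math. Phys. **99** (1985) 389–434
[`Balaban1985BackgroundPropagators`, "[B9]"]: (3.28)–(3.34) pp. 395–396 (*«R(U^u) = R(u)R(U)R(u⁻¹) … Δ_a(U^u) = R(u)Δ_a(U)R(u⁻¹), G(U^u) = R(u)G(U)R(u⁻¹)»*),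
Sect. C pp. 408–409 (the local operators `G′_□(U), C_□(U), G_□(U)`), Thm 3.11 proof p. 416 (*«Let us consider G_□(U) and let us make a gauge transformation
to the gauge in which U = e^{iηA} …»* — the step that needs the covariance of the LOCAL letters); T. Bałaban, *Propagators and renormalization transformations
for lattice gauge theories. II*, Commun. Math. Phys. **96** (1984) 223–250 [`Balaban1984PropagatorsII`], (2.17)–(2.20) pp. 225–226.

WHY THIS FILE (cell `pub-ymgap`, node N06, seat `pub-ymgap-dag-n06-j` = bundle F5 rows 15–17, g22, FILE 4a).  Print's road to the Cor. 3.6 positivity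
`hloc` of the padded local bond operator (the input of `…N06Row19LocalClauseAtDirichletInverses.hGsqA_of_GAsqY_pins`) is: (i) «G_□(1) is positive» — this seat's
`…N06Row17LocalClauseAtFlat.posDefTr_padDeltaALocY_one`; (ii) gauge covariance of that positivity to the cube gauge; (iii) the Sect.-B smallness of
`V(A)G_□(1)`.  THIS FILE is the algebraic content of (ii): def-Y's `OpsYGauge` proves (3.28)–(3.34) for the GLOBAL letters (`deltaPrimeAY_cov`, `GpY_cov`,
`XY_cov`, `RY_cov`, `deltaAY_cov`, `GAY_cov`); here the same `Intw` calculus is run through the Dirichlet compressions of FILE 35 (`dirPadY`, `dirInvY`,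
`cubeProjY`, `GsqY`) and the local letters of FILE 40 (`padXlocY`, `ClocY`, `PlocY`, `RlocY`, `deltaALocY`, `padDeltaALocY`, `GAsqY`) — real cut-offs
commute with `R(u)` (`B9Thm37CubeCoverCommutators.intw_cutMulY`) and `Ring.inverse` preserves intertwinings (`Intw.ringInverse`).

WHAT IS PROVED (0 `sorry`, 0 `def`; any complete normed ℂ-algebra fibre `𝔸`, any gauge function `g`, lawful site ∕ bond transporters where stated).
* §1 `intw_dirPadY`, `intw_dirInvY` (generic), `cubeProjY_intw`, ★ `GsqY_cov` (`G′_□(U^u)R(u) = R(u)G′_□(U)`), `GsqY_isCovSiteOpY`, `padDeltaY_cov`.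
* §2 `padXlocY_cov`, `ClocY_cov`, `PlocY_cov`, ★ `RlocY_cov`, ★★ `deltaALocY_cov` (`Δ_{a,□}(U^u)R(u) = R(u)Δ_{a,□}(U)`), ★★ `padDeltaALocY_cov`, ★ `GAsqY_cov`
  (`G_□(U^u)R(u) = R(u)G_□(U)`) — block cut `cutMulY χP`, bond cut `cutMulY χ`, real cut-offs.

HONEST SCOPE.  Ring identities (no estimate, no positivity); nothing of [B9]'s Thms 3.1–3.15 ∕ Cor. 3.6 is asserted; NOT a node discharge, NOT summit
progress; count-neutral; nothing continuum, nothing about the mass gap, no claim on the Clay problem.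
-/

namespace Literature.MathematicalPhysics.QuantumFieldTheory.Balaban1983to89.B9DeltaALocalGaugeCovY

open Literature.MathematicalPhysics.QuantumFieldTheory.Balaban1983to89.Node00
open Literature.MathematicalPhysics.QuantumFieldTheory.Balaban1983to89.Node00.OpsYLocalInverse (dirPadY dirInvY cubeProjY padDeltaY GsqY)
open Literature.MathematicalPhysics.QuantumFieldTheory.Balaban1983to89.Node00.OpsYDeltaALocal (padXlocY ClocY PlocY RlocY deltaALocY padDeltaALocY GAsqY)
open Literature.MathematicalPhysics.QuantumFieldTheory.Balaban1983to89.B6KLevelCensusIndexV1 (KIdx)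
open Literature.MathematicalPhysics.QuantumFieldTheory.Balaban1983to89.B9Thm37CubeCoverCommutators (cutMulY intw_cutMulY)

variable {𝔸 : Type} [NormedRing 𝔸] [NormedAlgebra ℂ 𝔸] [CompleteSpace 𝔸]

/-! ## §1 Padded compressions, Dirichlet local inverses and the cube inverse `G′_□(U)` -/

section Generic

variable {M : Type} [AddCommGroup M] [Module ℂ M] {σ : M →ₗ[ℂ] M} {P T T' : Module.End ℂ M}

/-- a padded compression `P T P + (1 − P)` intertwines whenever the cut and the operator do. [cite: Balaban1985BackgroundPropagators, (3.28)–(3.30) p.395, pp.408–409] -/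
theorem intw_dirPadY (hP : Intw σ σ P P) (hT : Intw σ σ T T') : Intw σ σ (dirPadY P T) (dirPadY P T') :=
  ((hP.comp hT).comp hP).add (Intw.id.sub hP)

/-- a Dirichlet local inverse `P (P T P + 1 − P)⁻¹ P` intertwines whenever the cut and the operator do (the intertwiner a unit).
[cite: Balaban1985BackgroundPropagators, (3.33) p.396, pp.408–409] -/
theorem intw_dirInvY (hσ : IsUnit σ) (hP : Intw σ σ P P) (hT : Intw σ σ T T') : Intw σ σ (dirInvY P T) (dirInvY P T') :=
  (hP.comp ((intw_dirPadY hP hT).ringInverse hσ)).comp hP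

end Generic

section Site

variable {d ℓ : ℕ} {hd : 1 ≤ d + 1} {hL : Odd (ℓ + 1) ∧ 1 < ℓ + 1} {b₀ b₁ : ℝ} (i : KIdx d ℓ hd hL b₀ b₁)
  (g : GaugeY 𝔸 i) (U : CfgY 𝔸 i) {parS : SiteParY 𝔸 i}

omit [CompleteSpace 𝔸] in
/-- the cube projection `P_D` (a real cut-off) commutes with the gauge action. [cite: Balaban1985BackgroundPropagators, (3.28) p.395, pp.408–409] -/
theorem cubeProjY_intw (γ : SiteY i → 𝔸ˣ) (D : Finset (SiteY i)) : Intw (conjY γ) (conjY γ) (cubeProjY (𝔸 := 𝔸) i D) (cubeProjY i D) :=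
  intw_cutMulY γ _

variable {i} in
/-- the padded compression of `Δ′_a(U)` to □̃ is covariant. [cite: Balaban1985BackgroundPropagators, (3.31)–(3.32) p.395, pp.408–409] -/
theorem padDeltaY_cov (hS : IsGaugeLawS i parS) (D : Finset (SiteY i)) :
    Intw (conjY (gSiteY i g)) (conjY (gSiteY i g)) (padDeltaY i parS D U) (padDeltaY i parS D (gaugeY i g U)) :=
  intw_dirPadY (cubeProjY_intw i _ D) (deltaPrimeAY_cov g U hS)

variable {i} in
/-- ★ **(3.33) FOR THE DIRICHLET CUBE INVERSE `G′_□(U)`**: `G′_□(U^u)R(u) = R(u)G′_□(U)`. [cite: Balaban1985BackgroundPropagators, (3.33) p.396, pp.408–409 (G′_□)] -/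
theorem GsqY_cov (hS : IsGaugeLawS i parS) (D : Finset (SiteY i)) :
    Intw (conjY (gSiteY i g)) (conjY (gSiteY i g)) (GsqY i parS D U) (GsqY i parS D (gaugeY i g U)) :=
  intw_dirInvY (isUnit_conjY _) (cubeProjY_intw i _ D) (deltaPrimeAY_cov g U hS)

variable {i} in
/-- hence `G′_□` is a covariant site letter in def-Y's sense. [cite: Balaban1985BackgroundPropagators, (3.33) p.396] -/
theorem GsqY_isCovSiteOpY (hS : IsGaugeLawS i parS) (D : Finset (SiteY i)) : IsCovSiteOpY i (GsqY i parS D) :=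
  fun g U => GsqY_cov g U hS D

end Site

/-! ## §2 The local letters of FILE 40: `C_□`, `P_□`, `R_□`, `Δ_{a,□}`, its padded compression, `G_□` -/

section Bond

variable {d ℓ : ℕ} {hd : 1 ≤ d + 1} {hL : Odd (ℓ + 1) ∧ 1 < ℓ + 1} {b₀ b₁ : ℝ} {i : KIdx d ℓ hd hL b₀ b₁}
  (g : GaugeY 𝔸 i) (U : CfgY 𝔸 i) {parS : SiteParY 𝔸 i} {parB : BondParY 𝔸 i}

/-- the padded block compression of `X_□ = Q′G′_□²Q′*` is covariant (real block cut-off). [cite: Balaban1985BackgroundPropagators, (3.33) p.396, pp.408–409 (C_□)] -/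
theorem padXlocY_cov (hS : IsGaugeLawS i parS) (D : Finset (SiteY i)) (χP : BlkY i → ℝ) :
    Intw (conjY (gBlkY i g)) (conjY (gBlkY i g)) (padXlocY i parS D (cutMulY χP) U) (padXlocY i parS D (cutMulY χP) (gaugeY i g U)) :=
  intw_dirPadY (intw_cutMulY _ χP) (XY_cov hS (GsqY_isCovSiteOpY hS D))

/-- **(3.33)′ for `C_□(U)`**: `C_□(U^u)R(u) = R(u)C_□(U)`. [cite: Balaban1985BackgroundPropagators, (3.33) p.396, pp.408–409 (C_□)] -/
theorem ClocY_cov (hS : IsGaugeLawS i parS) (D : Finset (SiteY i)) (χP : BlkY i → ℝ) :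
    Intw (conjY (gBlkY i g)) (conjY (gBlkY i g)) (ClocY i parS D (cutMulY χP) U) (ClocY i parS D (cutMulY χP) (gaugeY i g U)) :=
  intw_dirInvY (isUnit_conjY _) (intw_cutMulY _ χP) (XY_cov hS (GsqY_isCovSiteOpY hS D))

/-- (3.33)′ for `P_□(U) = G′_□Q′*C_□Q′G′_□`. [cite: Balaban1985BackgroundPropagators, (3.33) p.396, (3.105) p.414 (P_□)] -/
theorem PlocY_cov (hS : IsGaugeLawS i parS) (D : Finset (SiteY i)) (χP : BlkY i → ℝ) :
    Intw (conjY (gSiteY i g)) (conjY (gSiteY i g)) (PlocY i parS D (cutMulY χP) U) (PlocY i parS D (cutMulY χP) (gaugeY i g U)) :=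
  (GsqY_cov g U hS D).comp ((QpsY_cov g U hS).comp ((ClocY_cov g U hS D χP).comp ((QpY_cov g U hS).comp (GsqY_cov g U hS D))))

/-- ★ **(3.33) FOR THE LOCAL GAUGE PROJECTION**: `R_□(U^u)R(u) = R(u)R_□(U)`. [cite: Balaban1985BackgroundPropagators, (3.33) p.396 («R(U^u) = R(u)R(U)R(u⁻¹)»), (3.105) p.414] -/
theorem RlocY_cov (hS : IsGaugeLawS i parS) (D : Finset (SiteY i)) (χP : BlkY i → ℝ) :
    Intw (conjY (gSiteY i g)) (conjY (gSiteY i g)) (RlocY i parS D (cutMulY χP) U) (RlocY i parS D (cutMulY χP) (gaugeY i g U)) :=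
  Intw.id.sub (PlocY_cov g U hS D χP)

/-- ★★ **(3.34) FOR THE LOCAL BOND OPERATOR**: `Δ_{a,□}(U^u)R(u) = R(u)Δ_{a,□}(U)`. [cite: Balaban1985BackgroundPropagators, (3.34) p.396 («Δ_a(U^u) = R(u)Δ_a(U)R(u⁻¹)»), (3.105) p.414, pp.408–409] -/
theorem deltaALocY_cov (hS : IsGaugeLawS i parS) (hB : IsGaugeLawB i parB) (D : Finset (SiteY i)) (χP : BlkY i → ℝ) :
    Intw (conjY (gBondY i g)) (conjY (gBondY i g)) (deltaALocY i parS parB D (cutMulY χP) U)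
      (deltaALocY i parS parB D (cutMulY χP) (gaugeY i g U)) :=
  ((hessY_cov i g U).add ((gradY_cov i g U).comp ((RlocY_cov g U hS D χP).comp (divY_cov i g U)))).add
    ((QsY_cov g U hB).comp ((aY_cov i g).comp (QY_cov g U hB)))

/-- ★★ **(3.34) FOR THE PADDED COMPRESSION `M_χΔ_{a,□}(U)M_χ + (1 − M_χ)`** (real bond cut-off `χ`). [cite: Balaban1985BackgroundPropagators, (3.34) p.396, pp.408–409 (G_□)] -/
theorem padDeltaALocY_cov (hS : IsGaugeLawS i parS) (hB : IsGaugeLawB i parB) (D : Finset (SiteY i)) (χP : BlkY i → ℝ) (χ : FBondY i → ℝ) :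
    Intw (conjY (gBondY i g)) (conjY (gBondY i g)) (padDeltaALocY i parS parB D (cutMulY χP) (cutMulY χ) U)
      (padDeltaALocY i parS parB D (cutMulY χP) (cutMulY χ) (gaugeY i g U)) :=
  intw_dirPadY (intw_cutMulY _ χ) (deltaALocY_cov g U hS hB D χP)

/-- ★ **(3.34) FOR THE LOCAL BOND INVERSE `G_□(U)`**: `G_□(U^u)R(u) = R(u)G_□(U)`. [cite: Balaban1985BackgroundPropagators, (3.34) p.396 («G(U^u) = R(u)G(U)R(u⁻¹)»), pp.408–409 (G_□), Thm 3.11 proof p.416] -/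
theorem GAsqY_cov (hS : IsGaugeLawS i parS) (hB : IsGaugeLawB i parB) (D : Finset (SiteY i)) (χP : BlkY i → ℝ) (χ : FBondY i → ℝ) :
    Intw (conjY (gBondY i g)) (conjY (gBondY i g)) (GAsqY i parS parB D (cutMulY χP) (cutMulY χ) U)
      (GAsqY i parS parB D (cutMulY χP) (cutMulY χ) (gaugeY i g U)) :=
  intw_dirInvY (isUnit_conjY _) (intw_cutMulY _ χ) (deltaALocY_cov g U hS hB D χP)

end Bond

end Literature.MathematicalPhysics.QuantumFieldTheory.Balaban1983to89.B9DeltaALocalGaugeCovY
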